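import Summits.AtomisticToContinuum.Crystallization.Theses.ThreeConeCertificate
import Summits.AtomisticToContinuum.Crystallization.Theorems.ThreeConeCertificateOnePercentCertificateReduction
import Summits.AtomisticToContinuum.Crystallization.Theorems.ThreeConeCertificateOnePercentCertificateNearMinSiteEnergy
import Summits.AtomisticToContinuum.Crystallization.Theorems.ThreeConeCertificateOnePercentCertificateNearMinSeparation

/-!
# `OnePercentCertificate` (stmt-AtomisticToContinuum-11958) — line `perron-gauge`: hard-core reduction

Line `perron-gauge-Sketch` (skeleton `Cruxes/OnePercentCertificate/Lines/perron_gauge_Sketch.lean`, lead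
prover-line-stmt-AtomisticToContinuum-11958-a1-0).  Landed helper of this file's item:

* `local_of_stableOnSeparated` — **hard-core reduction**: `cS`-stability of the finite-range part `gS` of the
  tree split on `1/8`-SEPARATED injective configurations already gives `cS`-stability on ALL injective
  configurations.  Proof: an `ε`-minimiser of the `N`-particle `gS`-energy (`ε ≤ 1`) has all site energies
  `< ε` (removal inequality, `stub_nearMin_siteEnergy`, landed), hence is `1/8`-separated (closest-pair /
  shell-sum argument, `stub_separated_of_siteEnergy_le`, landed), so `E_gS(N) + ε ≥ −cS·N` for every
  `ε > 0`, and every configuration has energy `≥ E_gS(N)`.  This is the standard Xue / Blanc–Lewin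
  minimal-distance mechanism run for `gS`; it is what lets every local certificate of the line live on
  hard-core patterns (injectivity is load-bearing: `StubLocal.false_without_injective`).
All Props inlined; no definitions. [folklore]
-/

noncomputable section

open scoped BigOperators
open Literature.MathematicalPhysics.StatisticalMechanics
open Summit.AtomisticToContinuum.Crystallization.Theorems
open Summit.AtomisticToContinuum.Crystallization.Theorems.ThreeConeSplit

namespace Summit.AtomisticToContinuum.Crystallization.Theorems.PerronGauge

/-! ## `gS` is bounded below -/

/-- `bernsteinTail T r ≥ 0` for `T ≥ 0` (integral of a nonnegative function). [folklore] -/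
theorem hardCore_bernsteinTail_nonneg {T : ℝ} (hT : 0 ≤ T) (r : ℝ) : 0 ≤ bernsteinTail T r := by
  unfold bernsteinTail
  exact intervalIntegral.integral_nonneg hT fun t _ => by positivity

/-- `fS ≤ 21997/10⁵` everywhere (the two subtracted terms are nonnegative, `e^{−a r²} ≤ 1`). [folklore] -/
theorem hardCore_fS_le (r : ℝ) : fS r ≤ 21997 / 100000 := by
  unfold fS
  have h1 : Real.exp (-(169 / 100) * r ^ 2) ≤ 1 :=
    Real.exp_le_one_iff.2 (by nlinarith [sq_nonneg r])
  have h2 : 0 ≤ Real.exp (-(81 / 100) * r ^ 2) := (Real.exp_pos _).le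
  have h3 := hardCore_bernsteinTail_nonneg (by norm_num : (0 : ℝ) ≤ 36 / 25) r
  nlinarith

/-- `gS` is bounded below: `gS ≥ −(1/12 + 21997/10⁵)` (`V_LJ ≥ −1/12`, `fS ≤ 21997/10⁵`, and `gS = 0`
beyond the range). [folklore] -/
theorem hardCore_gS_lower (r : ℝ) : -(1 / 12 + 21997 / 100000) ≤ gS r := by
  unfold gS
  split_ifs
  · have h1 := neg_one_div_le_lennardJones r
    have h2 := hardCore_fS_le r
    linarith
  · norm_num

/-- The `gS`-energies of injective `N`-point configurations are bounded below. [folklore] -/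
theorem hardCore_bddBelow_energy (N : ℕ) :
    BddBelow (Set.range fun y : {y : Fin N → EuclideanSpace ℝ (Fin 3) // Function.Injective y} =>
      interactionEnergy gS y.1) := by
  refine ⟨∑ i : Fin N, ((Finset.Ioi i).card : ℝ) * (-(1 / 12 + 21997 / 100000)), ?_⟩
  rintro _ ⟨y, rfl⟩
  exact le_interactionEnergy_of_le gS hardCore_gS_lower y.1

/-! ## Hard-core reduction -/

/-- **Hard-core reduction for the tree split.** `cS`-stability of `gS` on `1/8`-separated injective
configurations implies `cS`-stability of `gS` on all injective configurations: for `0 < ε ≤ 1` an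
`ε`-minimiser `y` of `E_gS(N)` has site energies `< ε` (`stub_nearMin_siteEnergy`), so is `1/8`-separated
(`stub_separated_of_siteEnergy_le`), so `−cS·N ≤ E_gS(y) < E_gS(N) + ε ≤ E_gS(x) + ε`.
[cite: Xue1997, Main Theorem; BlancLewin2015, §2.2] -/
theorem local_of_stableOnSeparated :
    (∀ (N : ℕ) (x : Fin N → EuclideanSpace ℝ (Fin 3)), Function.Injective x →
      (∀ i j, i ≠ j → (1 / 8 : ℝ) ≤ dist (x i) (x j)) → -(cS * (N : ℝ)) ≤ interactionEnergy gS x) →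
    ∀ (N : ℕ) (x : Fin N → EuclideanSpace ℝ (Fin 3)), Function.Injective x →
      -(cS * (N : ℝ)) ≤ interactionEnergy gS x := by
  intro h3 N x hx
  haveI : Nonempty {y : Fin N → EuclideanSpace ℝ (Fin 3) // Function.Injective y} := ⟨⟨x, hx⟩⟩
  have hm : groundStateEnergy gS 3 N ≤ interactionEnergy gS x :=
    ciInf_le (hardCore_bddBelow_energy N)
      (⟨x, hx⟩ : {y : Fin N → EuclideanSpace ℝ (Fin 3) // Function.Injective y})
  suffices hε : ∀ ε, 0 < ε → -(cS * (N : ℝ)) ≤ groundStateEnergy gS 3 N + ε by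
    exact (le_of_forall_pos_le_add hε).trans hm
  intro ε hε
  set ε' := min ε 1 with hε'
  have hε'pos : 0 < ε' := lt_min hε one_pos
  have hlt : groundStateEnergy gS 3 N < groundStateEnergy gS 3 N + ε' := lt_add_of_pos_right _ hε'pos
  obtain ⟨⟨y, hy⟩, hylt⟩ := exists_lt_of_ciInf_lt hlt
  have hsite : ∀ i, siteEnergy gS y i ≤ 1 := fun i =>
    (stub_nearMin_siteEnergy N y ε' hy hylt i).le.trans (min_le_right _ _)
  have hsep := stub_separated_of_siteEnergy_le N y hy hsite
  have hstab := h3 N y hy hsep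
  have hmin : ε' ≤ ε := min_le_left _ _
  linarith

end Summit.AtomisticToContinuum.Crystallization.Theorems.PerronGauge
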